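import Literature.MathematicalPhysics.QuantumFieldTheory.BalabanImbrieJaffe1984to88.BIJ88Eq5128Frame

/-!
# `BalabanImbrieJaffe1984to88.BIJ88Eq5128Locality` — T. Bałaban, J. Imbrie, A. Jaffe, *Effective action and cluster properties of the
abelian Higgs model*, Commun. Math. Phys. **114** (1988) 257–315 [BalabanImbrieJaffe1988], (5.12.8) p. 303 [PDF 47] with (2.10)–(2.11) of
[BalabanImbrieJaffe1985] (Commun. Math. Phys. **97**, p. 303) — **THE LOCALITY HYPOTHESIS OF THE CONDITIONING, INSTANTIATED BY NAME FOR THE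
BLOCK AVERAGE `Qu` OF RECORD (PROVED).**

statement-level skeleton of published theorems with citation tags; proofs where landed; nothing here is a claim about the Yang–Mills mass gap

THE PRINT.  (2.10)–(2.11) of [BalabanImbrieJaffe1985] (r18's `BIJ85BlockAveragesTorus.qU`, the block average of record): *"(Qu)_{yy′} = u(Γ_{yy′})
exp[L^{−d} Σ_{x∈B(y)} ln u(Γ_{yx} ∘ Γ_{xx′} ∘ Γ_{y′x′}^{−1} ∘ Γ_{y′y})]"* — `(Qu)_c` for the block bond `c = ⟨y, y′ = y + e_μ⟩` is a function of
the fine bond variables on the straight runs `Γ_{yy′}`, `Γ_{xx′}` (`x ∈ B(y)`, `x′ = x + Le_μ ∈ B(y′)`) and on the tree contours `Γ_{yx} ⊂ B(y)`,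
`Γ_{y′x′} ⊂ B(y′)` ONLY.  [BalabanImbrieJaffe1988] p. 300 [PDF 44]: the regions are nested, `Λ^{(k)}_{10} ⊂ Λ̃^{(k)}_9 ⊂ Λ^{(k)}_9 ⊂ Λ̃^{(k)}_8 ⊂ …`,
each obtained from the previous by deletions and collars of width `r(e_k)`; line 2 of (5.12.8) keeps `δ_{Λ^{(k)′*c}_1}(v/Qu^{(k)})` — the block
field is tied to `Qu^{(k)}` only OFF `Λ^{(k)′*}_1`, far from the interior region `Λ^{(k)}_{10}` whose bond variables the conditioning integrates.

WHAT IS PROVED HERE (0 `sorry`; no `Prop`-valued fact; standard axioms).  §1 `runBonds`, `holBonds`, **`qUSupport c`** — the finite set of fine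
bonds entering `(Qu)_c` by (2.10), DEFINED from r18's `runBond`/`legBond`/`block`/`corner`/`runSite`; the congruences `runC_congr`, `runArg_congr`,
`legProd_congr`, `holC_congr`, `loopC_congr`, `loopAvg_congr` and **`qU_congr`**: two gauge fields agreeing on `qUSupport c` have the same `(Qu)_c`
(PROVED by unfolding (2.10)).  §2 **`vCut_freeze_eq_qU`**: the hypothesis `hv` of this seat's `BIJ88Eq5128Frame.isDC_of_isDT` FOR `Qu = qU` under
the printed nesting in its combinatorial form — *no fine bond of `(Qu)_c`, `c ∉ Λ_t` (= `Λ^{(k)′*}_1`), is an interior bond of the conditioning*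
(`qUSupport c ∩ Λ^{(k)c*c}_{10} = ∅`); `isDC_of_isDT_qU`: the conditioning theorem with `hv` so discharged.  This is one of the two by-name
instantiations of the owner's flip condition for row C2.Eq5.12.8 (r16 INBOX 2026-08-22T02:48:36Z: *"`hv` derived from the p.300 nesting"*); the
other (`hfac` from the (5.12.1)–(5.12.7) theorems of record on the torus carriers) is not attempted here.
Seat p34 gen 10, file 7 (own lineage).

CITATION HEADER (lean-in-tree rule).  Part of the lit-balaban TYPED SKELETON (HOME `run/shared/lean/pub/lit-balaban/`), PHASE-2 proof seat p34
gen 10 (unit `lit-balaban-p34-g10`).  Rows served: **`C2.Eq5.12.8`** (member: locality instantiated by name); xref `C1.Eq2.10-2.11` (r18's `qU`).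
PDF held: `paper:balaban1988-cmp114-bij-abelian-higgs-effective-action` (journal page = PDF page + 256).  Imports this seat's `BIJ88Eq5128Frame`
(whose closure contains r18's `BIJ85BlockAveragesTorus`); Literature + Mathlib only.
-/

namespace Literature.MathematicalPhysics.QuantumFieldTheory.BalabanImbrieJaffe1984to88.BIJ88Eq5128Locality

open Literature.MathematicalPhysics.QuantumFieldTheory.Balaban1983to89
open BIJ88Sect3Statements (U1 toC)
open BIJ85Sect1Model (HiggsField argB)
open BIJ88RenormTransf311 (inBlock)
open BIJ88InductiveForm41 (Prev)
open BIJ85BlockAveragesTorus (qU measurable_qU runArg loopAvg loopC holC legProd runC runBond legBond corner runSite)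
open BIJ88Eq596Display (uCut vCut IsDT)
open BIJ88Eq5128Split (Cfg Interior)
open BIJ88Eq5128Display (IsDC termIntegrand termMeasure)
open BIJ88Eq5128Display.Weight (normW condW)
open BIJ88Eq5128Frame (vCut_freeze_eq isDC_of_isDT)
open scoped BigOperators
open _root_.MeasureTheory Finset

noncomputable section

variable {P : Params} {j : ℕ}

/-! ## §1 The fine bonds entering `(Qu)_c` and the congruence -/

/-- The bonds `⟨x + te_μ, μ⟩`, `t < L`, of the straight run `Γ_{xx′}` ((2.10): `u(Γ_{xx′}) = Π_t u(b_t)`, r18's `runC`/`runArg`).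
[cite: BalabanImbrieJaffe1985, (2.10) p.303] -/
def runBonds (x : Balaban1983to89.Site P j) (μ : Fin P.d) : Finset (PBond P j) := (range P.L).image (runBond x μ)

/-- The bonds of the tree contour `Γ_{yx}` from the corner of the block of `x` to `x` ((2.5), r18's `holC` = product over the legs `legBond x μ t`,
`t < inBlock x μ`). [cite: BalabanImbrieJaffe1985, (2.5) p.302] -/
def holBonds (x : Balaban1983to89.Site P j) : Finset (PBond P j) := univ.biUnion fun μ : Fin P.d => (range (inBlock x μ)).image (legBond x μ)

/-- **The fine bonds entering `(Qu)_c` by (2.10)**, `c = ⟨y, y + e_μ⟩`: the run `Γ_{yy′}` from the corner of `B(y)`, and for every `x ∈ B(y)` the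
contour `Γ_{yx}`, the run `Γ_{xx′}` and the contour `Γ_{y′x′}` (`x′ = x + Le_μ`). [cite: BalabanImbrieJaffe1985, (2.10) p.303] -/
def qUSupport (c : PBond P (j+1)) : Finset (PBond P j) :=
  runBonds (corner c.src) c.dir ∪ (block c.src).biUnion fun x => holBonds x ∪ runBonds x c.dir ∪ holBonds (runSite x c.dir P.L)

/-- kernel: membership in the run support. [cite: BalabanImbrieJaffe1985, (2.10) p.303] -/
theorem runBond_mem_runBonds {x : Balaban1983to89.Site P j} {μ : Fin P.d} {t : ℕ} (ht : t ∈ range P.L) : runBond x μ t ∈ runBonds x μ :=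
  mem_image_of_mem _ ht

/-- kernel: membership in the contour support. [cite: BalabanImbrieJaffe1985, (2.5) p.302] -/
theorem legBond_mem_holBonds {x : Balaban1983to89.Site P j} {μ : Fin P.d} {t : ℕ} (ht : t ∈ range (inBlock x μ)) :
    legBond x μ t ∈ holBonds x :=
  mem_biUnion.2 ⟨μ, mem_univ _, mem_image_of_mem _ ht⟩

variable {U U' : GaugeField P j U1}

/-- kernel: `u(Γ_{xx′})` depends on the run bonds only. [cite: BalabanImbrieJaffe1985, (2.10) p.303] -/
theorem runC_congr {x : Balaban1983to89.Site P j} {μ : Fin P.d} (h : ∀ b ∈ runBonds x μ, U b = U' b) : runC U x μ = runC U' x μ :=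
  prod_congr rfl fun t ht => by rw [h _ (runBond_mem_runBonds ht)]

/-- kernel: the run phase depends on the run bonds only. [cite: BalabanImbrieJaffe1985, (2.11) p.303] -/
theorem runArg_congr {x : Balaban1983to89.Site P j} {μ : Fin P.d} (h : ∀ b ∈ runBonds x μ, U b = U' b) : runArg U x μ = runArg U' x μ :=
  sum_congr rfl fun t ht => by rw [h _ (runBond_mem_runBonds ht)]

/-- kernel: a leg product depends on the contour bonds only. [cite: BalabanImbrieJaffe1985, (2.5) p.302] -/
theorem legProd_congr {x : Balaban1983to89.Site P j} (h : ∀ b ∈ holBonds x, U b = U' b) (μ : Fin P.d) : legProd U x μ = legProd U' x μ :=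
  prod_congr rfl fun t ht => by rw [h _ (legBond_mem_holBonds ht)]

/-- kernel: `u(Γ_{yx})` depends on the contour bonds only. [cite: BalabanImbrieJaffe1985, (2.5) p.302] -/
theorem holC_congr {x : Balaban1983to89.Site P j} (h : ∀ b ∈ holBonds x, U b = U' b) : holC U x = holC U' x :=
  prod_congr rfl fun μ _ => legProd_congr h μ

/-- kernel: the closed contour of (2.10) at `x ∈ B(y)` depends on `Γ_{yx}`, `Γ_{xx′}`, `Γ_{y′x′}`, `Γ_{yy′}` only. [cite: BalabanImbrieJaffe1985, (2.10) p.303] -/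
theorem loopC_congr {c : PBond P (j+1)} {x : Balaban1983to89.Site P j} (hx : ∀ b ∈ holBonds x, U b = U' b)
    (hr : ∀ b ∈ runBonds x c.dir, U b = U' b) (hx' : ∀ b ∈ holBonds (runSite x c.dir P.L), U b = U' b)
    (hc : ∀ b ∈ runBonds (corner c.src) c.dir, U b = U' b) : loopC U c x = loopC U' c x := by
  unfold loopC
  rw [holC_congr hx, runC_congr hr, holC_congr hx', runC_congr hc]

/-- kernel: the averaged loop phase depends on the support bonds only. [cite: BalabanImbrieJaffe1985, (2.11) p.303] -/
theorem loopAvg_congr {c : PBond P (j+1)} (h : ∀ b ∈ qUSupport c, U b = U' b) : loopAvg U c = loopAvg U' c := by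
  unfold loopAvg
  congr 1
  refine sum_congr rfl fun x hx => ?_
  have hc : ∀ b ∈ runBonds (corner c.src) c.dir, U b = U' b := fun b hb => h b (mem_union_left _ hb)
  have hX : ∀ b, b ∈ holBonds x ∪ runBonds x c.dir ∪ holBonds (runSite x c.dir P.L) → U b = U' b :=
    fun b hb => h b (mem_union_right _ (mem_biUnion.2 ⟨x, hx, hb⟩))
  rw [loopC_congr (fun b hb => hX b (mem_union_left _ (mem_union_left _ hb)))
    (fun b hb => hX b (mem_union_left _ (mem_union_right _ hb))) (fun b hb => hX b (mem_union_right _ hb)) hc]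

/-- **LOCALITY OF THE BLOCK AVERAGE OF RECORD**: two gauge fields that agree on the fine bonds `qUSupport c` of (2.10) have the same `(Qu)_c`.
[cite: BalabanImbrieJaffe1985, (2.10) p.303] -/
theorem qU_congr {c : PBond P (j+1)} (h : ∀ b ∈ qUSupport c, U b = U' b) : qU U c = qU U' c := by
  unfold qU
  rw [runArg_congr (fun b hb => h b (mem_union_left _ hb)), loopAvg_congr h]

/-! ## §2 The locality hypothesis of the conditioning for `Qu = qU` -/

section Conditioning

variable {k : ℕ}

/-- **THE HYPOTHESIS `hv` OF `isDC_of_isDT` FOR THE BLOCK AVERAGE OF RECORD, FROM THE NESTING**: if no fine bond entering `(Qu)_c` for a block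
bond `c` off the cut-off `Λ₀` (= `Λ^{(k)′*}_1`, where line 2 of (5.12.8) keeps `δ(v/Qu^{(k)})`) is an interior bond of the conditioning
(`D.Ib` = `Λ^{(k)c*c}_{10}`; print: `Λ^{(k)}_{10}` lies inside `Λ^{(k)}_1` by the p. 300 chain of deletions and collars), then the block field seen by
the test function is unchanged by freezing the interior bond variables. [cite: BalabanImbrieJaffe1988, (5.12.8) p.303] -/
theorem vCut_freeze_eq_qU (D : Interior P k) (Λ₀ : Finset (PBond P (k+1)))
    (hIb : ∀ c, c ∉ Λ₀ → ∀ b ∈ qUSupport c, b ∉ D.Ib) (q : Cfg P k) (v' : GaugeField P (k+1) U1) :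
    vCut qU Λ₀ (D.freeze q).1 v' = vCut qU Λ₀ q.1 v' := by
  refine vCut_freeze_eq D Λ₀ (Qu := qU) (fun u u' hu c hc => ?_) q v'
  exact qU_congr (U := u) (U' := u') (c := c) fun b hb => hu b (hIb c hc b hb)

variable {ι : Type*} {terms : Finset ι} {Λ : ι → Finset (PBond P (k+1))}
variable {m : PBond P k → Measure U1} [∀ b, IsProbabilityMeasure (m b)]
variable {J : ι → Prev P k → GaugeField P k U1 → GaugeField P (k+1) U1 → HiggsField P k → HiggsField P (k+1) → ℂ}
variable {ρL : GaugeField P (k+1) U1 → HiggsField P (k+1) → ℂ}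

/-- **(5.9.6) ⇒ (5.12.8) FOR THE BLOCK AVERAGE OF RECORD, LOCALITY DISCHARGED**: `BIJ88Eq5128Frame.isDC_of_isDT` with `Qu = qU` (measurable by
r18's `measurable_qU`) and the hypothesis `hv` replaced by the combinatorial nesting `hIb` (no fine bond of `(Qu)_c`, `c ∉ Λ_t`, is interior).
[cite: BalabanImbrieJaffe1988, (5.12.8) p.303] -/
theorem isDC_of_isDT_qU (h : IsDT (Measure.pi m) terms Λ qU J ρL) (D : ι → Interior P k) (Xf B : ι → Cfg P k → GaugeField P (k+1) U1 → HiggsField P (k+1) → ℂ)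
    (W : ι → Cfg P k → GaugeField P (k+1) U1 → HiggsField P (k+1) → ℝ)
    (hIb : ∀ t ∈ terms, ∀ c, c ∉ Λ t → ∀ b ∈ qUSupport c, b ∉ (D t).Ib)
    (hfac : ∀ t ∈ terms, ∀ (q : Cfg P k) (v' : GaugeField P (k+1) U1) (ψ : HiggsField P (k+1)),
      J t q.2.1 (uCut qU (Λ t) q.1) (vCut qU (Λ t) q.1 v') q.2.2 ψ = Xf t ((D t).freeze q) v' ψ * (W t q v' ψ : ℂ) * B t q v' ψ)
    (hWm : ∀ t ∈ terms, Measurable fun p : Cfg P k × (GaugeField P (k+1) U1 × HiggsField P (k+1)) => W t p.1 p.2.1 p.2.2)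
    (hW0 : ∀ t ∈ terms, ∀ q v' ψ, 0 < W t q v' ψ)
    (hWi : ∀ t ∈ terms, ∀ (e : (D t).Ext) (v' : GaugeField P (k+1) U1) (ψ : HiggsField P (k+1)),
      Integrable (fun i => W t ((D t).glue e i) v' ψ) ((D t).μInt m))
    (hJi : ∀ t ∈ terms, Integrable (termIntegrand Λ qU J t) (termMeasure (Measure.pi m))) :
    IsDC terms Λ qU (fun t => (D t).extMeasure m)
      (fun t q v' ψ => Xf t q v' ψ * (normW (D t) m (fun q' => W t q' v' ψ) q : ℂ))
      (fun t q v' ψ => condW (D t) m (fun q' => W t q' v' ψ) q) B ρL :=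
  isDC_of_isDT h measurable_qU D Xf B W (fun t ht q v' => vCut_freeze_eq_qU (D t) (Λ t) (hIb t ht) q v') hfac hWm hW0 hWi hJi

end Conditioning

end

end Literature.MathematicalPhysics.QuantumFieldTheory.BalabanImbrieJaffe1984to88.BIJ88Eq5128Locality
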